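import Mathlib.RingTheory.AlgebraicIndependent.AlgebraicClosure
import Mathlib.RingTheory.AlgebraicIndependent.Transcendental
import Mathlib.LinearAlgebra.Dimension.Free
import Literature.FieldTheory.Regular.RacPurelyTranscendental
import HarnessLib

/-!
# [AbsTopIII] Rmk. 1.5.4 (iii): finitely generated, relatively algebraically closed subfields of a finite extension of `k(x_i)_{i ∈ I}`

Mochizuki, *Topics in Absolute Anabelian Geometry III*, §1, Remark 1.5.4 (iii), p. 34 (lit key
`paper:url-5493eb38cbb7`), verbatim: "observe that if, for instance, `I` is an infinite set, then the
field `k := ℚ_p(x_i)_{i ∈ I}` [which is not a finitely generated extension of `ℚ_p`] constitutes an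
example of a Kummer-faithful field which is not sub-`p`-adic. Indeed, if, for `H`, `A` as in
Definition 1.5, `0 ≠ f ∈ A(k_H)` lies in the kernel of the associated Kummer map, then observe that
there exists some finite subset `I′ ⊆ I` such that if we set `k′ := ℚ_p(x_i)_{i ∈ I′}`, then, for some
finite extension `k′_H ⊆ k_H` of `k′`, we may assume that `A` descends to a semi-abelian variety `A′`
over `k′_H`, that `f ∈ A′(k′_H) ⊆ A(k_H)`, and that `k_H = k′_H(x_i)_{i ∈ I″}`, where we set
`I″ := I ∖ I′`. Since `k′_H` is algebraically closed in `k_H`, it thus follows that all roots of `f`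
defined over `k_H` are in fact defined over `k′_H`. Thus, the existence of `f` contradicts the fact
that the sub-`p`-adic field `k′_H` is Kummer-faithful."  (Gloss, not print: `k_H = k′_H(x_i)_{i ∈ I″}`
says that `k_H` is purely transcendental over the finitely generated field `k′_H`.)

This PROOF-ONLY file turns the step «`k_H = k′_H(x_i)_{i ∈ I″}` with `k′_H` algebraically closed in `k_H`»
into a reusable LEMMA (it is the field-theoretic core of
`divisibleElementsTrivial_units_of_finite_adjoin_algebraicIndependent`,
`KummerFaithfulPurelyTranscendentalProofs.lean`, where it is proved inline for the coordinates of one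
unit): for a family `z : I → E` algebraically independent over `k` with `E` FINITE over `k(z_I)`, and
any finite subset `T ⊆ E` (in characteristic `0`, as the tree's relative-algebraic-closedness
lemma is stated), there is an intermediate field `E_J` (namely `k(z_J)(b)` for a finite
`J ⊆ I` and a `k(z_I)`-basis `b` of `E`) which

* contains `T`,
* is finitely generated over `k` (`IntermediateField.FG`), and
* is RELATIVELY ALGEBRAICALLY CLOSED in `E`: every element of `E` algebraic over `E_J` lies in `E_J`
  (because `E = E_J(z_{I ∖ J})` is purely transcendental over `E_J`; tree:
  `Literature.FieldTheory.Regular.mem_of_isAlgebraic_of_mem_adjoin_of_algebraicIndependent`).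

Route memo F0371-AV-ROUTE (cell abc-iut), junction J2: with `k = ℚ_p` this is the field over which an
abelian variety over `E`, one of its rational points, and then all the `N`-th roots of that point are
defined. Mathlib + tree only; nothing here bears on [IUTchIII] Cor. 3.12.
v2: module/decl docstrings re-quoted VERBATIM from p. 34 (RQ7 note abc-iut-aud-15: the v1 text in
quotation marks was a paraphrase); declarations unchanged.
-/

noncomputable section

open scoped Classical IntermediateField.algebraAdjoinAdjoin
open Polynomial

namespace Literature.AnabelianGeometry.AbsoluteAnabelian.AbsTopIII

universe u

section Helpers

variable {k : Type*} {E : Type*} [Field k] [Field E] [Algebra k E]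

/-- An element algebraic over an intermediate field `F` is a root of a nonzero polynomial over the
big field all of whose coefficients lie in `F`. [cite: MochizukiAbsTopIII2015, Rmk 1.5.4 (iii) p.34] -/
private theorem exists_poly_of_isAlgebraic' (F : IntermediateField k E) {a : E}
    (ha : IsAlgebraic F a) :
    ∃ P : E[X], P ≠ 0 ∧ (∀ n, P.coeff n ∈ F) ∧ P.IsRoot a := by
  obtain ⟨p, hp0, hpa⟩ := ha
  refine ⟨p.map (algebraMap F E), ?_, fun n => ?_, ?_⟩
  · exact fun h => hp0 ((Polynomial.map_eq_zero_iff (algebraMap F E).injective).mp h)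
  · rw [Polynomial.coeff_map]
    exact (p.coeff n).2
  · rw [Polynomial.IsRoot.def, Polynomial.eval_map, ← Polynomial.aeval_def]
    exact hpa

/-- Conversely, a root of a nonzero polynomial with coefficients in the intermediate field `F` is
algebraic over `F`. [cite: MochizukiAbsTopIII2015, Rmk 1.5.4 (iii) p.34] -/
private theorem isAlgebraic_of_poly' (F : IntermediateField k E) {a : E} (P : E[X]) (hP0 : P ≠ 0)
    (hcoef : ∀ n, P.coeff n ∈ F) (hroot : P.IsRoot a) : IsAlgebraic F a := by
  have hl : P ∈ Polynomial.lifts (algebraMap F E) :=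
    (Polynomial.lifts_iff_coeff_lifts P).mpr fun n => ⟨⟨P.coeff n, hcoef n⟩, rfl⟩
  obtain ⟨q, hq⟩ := (Polynomial.mem_lifts P).mp hl
  refine ⟨q, ?_, ?_⟩
  · rintro rfl
    exact hP0 (by rw [← hq, Polynomial.map_zero])
  · rw [Polynomial.aeval_def, ← Polynomial.eval_map, hq]
    exact hroot

end Helpers

/-- **Finitely generated, relatively algebraically closed subfields containing any finite set**
([AbsTopIII] Rmk. 1.5.4 (iii) p. 34: "there exists some finite subset `I′ ⊆ I` such that [...]
`k_H = k′_H(x_i)_{i ∈ I″}` [...] `k′_H` is algebraically closed in `k_H`", as a lemma for an arbitrary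
finite subset of `k_H` in place of the data of `A` and `f`). Let `z : I → E` be algebraically independent over `k`
(any index type `I`) with `E` finite over `k(z_I)`. For every finite `T ⊆ E` there is an intermediate
field `E_J` of `E / k` containing `T`, finitely generated over `k`, and such that every element of `E`
algebraic over `E_J` lies in `E_J` — `E_J = k(z_J)(b)` for `J ⊆ I` finite and `b` a basis of `E` over
`k(z_I)`, and `E = E_J(z_{I ∖ J})` is purely transcendental over it.
[cite: MochizukiAbsTopIII2015, Rmk 1.5.4 (iii) p.34] -/
theorem exists_fg_intermediateField_relAlgClosed {k E : Type u} [Field k] [Field E] [Algebra k E]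
    [CharZero E] {I : Type*} (z : I → E) (hz : AlgebraicIndependent k z)
    [Module.Finite (IntermediateField.adjoin k (Set.range z)) E] (T : Finset E) :
    ∃ EJ : IntermediateField k E, (↑T : Set E) ⊆ EJ ∧ EJ.FG ∧
      ∀ y : E, IsAlgebraic EJ y → y ∈ EJ := by
  classical
  set FI : IntermediateField k E := IntermediateField.adjoin k (Set.range z) with hFI
  -- a basis of `E` over `FI = k(z_I)`; algebraic equations of its members; coordinates of `T`
  let b := Module.finBasis FI E
  have hbalg : ∀ m, ∃ P : E[X], P ≠ 0 ∧ (∀ n, P.coeff n ∈ FI) ∧ P.IsRoot (b m) := fun m =>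
    exists_poly_of_isAlgebraic' FI (Algebra.IsAlgebraic.isAlgebraic (b m))
  choose P hP0 hPcoef hProot using hbalg
  have hT : ∀ m n, ∃ S : Finset E, (S : Set E) ⊆ Set.range z ∧
      (P m).coeff n ∈ IntermediateField.adjoin k (S : Set E) := fun m n =>
    IntermediateField.exists_finset_of_mem_adjoin (hPcoef m n)
  choose Tc hTcsub hTcmem using hT
  have hT' : ∀ (t : T) (m), ∃ S : Finset E, (S : Set E) ⊆ Set.range z ∧
      ((b.repr (t : E) m : FI) : E) ∈ IntermediateField.adjoin k (S : Set E) := fun t m =>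
    IntermediateField.exists_finset_of_mem_adjoin (b.repr (t : E) m).2
  choose T' hT'sub hT'mem using hT'
  -- the finitely many variables involved
  let S₀ : Finset E :=
    (Finset.univ.biUnion fun m => (P m).support.biUnion (Tc m)) ∪
      (Finset.univ.biUnion fun tm : T × _ => T' tm.1 tm.2)
  have hS₀sub : (S₀ : Set E) ⊆ Set.range z := by
    intro e he
    rw [Finset.mem_coe] at he
    rcases Finset.mem_union.mp he with h | h
    · obtain ⟨m, -, hm⟩ := Finset.mem_biUnion.mp h
      obtain ⟨n, -, hn⟩ := Finset.mem_biUnion.mp hm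
      exact hTcsub m n hn
    · obtain ⟨tm, -, htm⟩ := Finset.mem_biUnion.mp h
      exact hT'sub tm.1 tm.2 htm
  have hTS : ∀ m, ∀ n ∈ (P m).support, (Tc m n : Set E) ⊆ S₀ := fun m n hn e he => by
    rw [Finset.mem_coe] at he ⊢
    exact Finset.mem_union_left _
      (Finset.mem_biUnion.mpr ⟨m, Finset.mem_univ m, Finset.mem_biUnion.mpr ⟨n, hn, he⟩⟩)
  have hT'S : ∀ (t : T) (m), (T' t m : Set E) ⊆ S₀ := fun t m e he => by
    rw [Finset.mem_coe] at he ⊢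
    exact Finset.mem_union_right _ (Finset.mem_biUnion.mpr ⟨(t, m), Finset.mem_univ _, he⟩)
  -- the finite set of indices `s` ("`J`") and the field `FJ = k(z_J)`
  let s : Set I := z ⁻¹' (S₀ : Set E)
  have hzs : z '' s = (S₀ : Set E) := Set.image_preimage_eq_of_subset hS₀sub
  set FJ : IntermediateField k E := IntermediateField.adjoin k (z '' s) with hFJ
  have hmemFJ : ∀ {X : Finset E}, (X : Set E) ⊆ S₀ → ∀ {e : E},
      e ∈ IntermediateField.adjoin k (X : Set E) → e ∈ FJ := fun hX e he => by
    rw [hFJ, hzs]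
    exact IntermediateField.adjoin.mono k _ _ hX he
  have hPcoefJ : ∀ m n, (P m).coeff n ∈ FJ := by
    intro m n
    by_cases hn : n ∈ (P m).support
    · exact hmemFJ (hTS m n hn) (hTcmem m n)
    · rw [Polynomial.notMem_support_iff.mp hn]
      exact zero_mem _
  have hreprJ : ∀ (t : T) (m), ((b.repr (t : E) m : FI) : E) ∈ FJ := fun t m =>
    hmemFJ (hT'S t m) (hT'mem t m)
  have hbalgJ : ∀ m, IsAlgebraic FJ (b m) := fun m =>
    isAlgebraic_of_poly' FJ (P m) (hP0 m) (hPcoefJ m) (hProot m)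
  -- the field `EJ = k(z_J)(b)`, as an intermediate field of `E/k`
  set EJ : IntermediateField k E :=
    (IntermediateField.adjoin FJ (Set.range b)).restrictScalars k with hEJ
  have hFJ_EJ : FJ ≤ EJ := fun e he =>
    (IntermediateField.adjoin FJ (Set.range b)).algebraMap_mem ⟨e, he⟩
  have hb_EJ : ∀ m, b m ∈ EJ := fun m =>
    IntermediateField.subset_adjoin FJ (Set.range b) ⟨m, rfl⟩
  have hT_EJ : ∀ t : T, (t : E) ∈ EJ := by
    intro t
    rw [← b.sum_repr (t : E)]
    refine sum_mem fun m _ => ?_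
    rw [Algebra.smul_def]
    exact mul_mem (hFJ_EJ (hreprJ t m)) (hb_EJ m)
  -- `EJ` is algebraic over `FJ`
  letI : Algebra FJ EJ := (IntermediateField.inclusion hFJ_EJ).toRingHom.toAlgebra
  haveI : IsScalarTower FJ EJ E := IsScalarTower.of_algebraMap_eq (fun _ => rfl)
  haveI hEJalg₀ : Algebra.IsAlgebraic FJ (IntermediateField.adjoin FJ (Set.range b)) :=
    IntermediateField.isAlgebraic_adjoin (fun x hx => by
      obtain ⟨m, rfl⟩ := hx
      exact (hbalgJ m).isIntegral)
  haveI : Algebra.IsAlgebraic FJ EJ := ⟨fun y => by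
    have hy : (y : E) ∈ IntermediateField.adjoin FJ (Set.range b) := y.2
    have hyE : IsAlgebraic FJ (y : E) :=
      (isAlgebraic_algHom_iff (IntermediateField.adjoin FJ (Set.range b)).val
        Subtype.val_injective).mpr (hEJalg₀.isAlgebraic ⟨(y : E), hy⟩)
    exact (isAlgebraic_algHom_iff (IsScalarTower.toAlgHom FJ EJ E) Subtype.val_injective).mp hyE⟩
  -- the remaining variables are algebraically independent over `EJ` ...
  have hzT : AlgebraicIndependent EJ (fun i : ↥sᶜ => z i) := by
    have h1 : AlgebraicIndependent (Algebra.adjoin k (z '' s)) (fun i : ↥sᶜ => z i) :=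
      hz.adjoin_of_disjoint disjoint_compl_right
    have h2 : AlgebraicIndependent FJ (fun i : ↥sᶜ => z i) :=
      IntermediateField.algebraicIndependent_adjoin_iff.mpr h1
    exact h2.extendScalars EJ
  -- ... and generate `E` over `EJ`
  have htop : IntermediateField.adjoin EJ (Set.range fun i : ↥sᶜ => z i) = ⊤ := by
    rw [eq_top_iff]
    intro e _
    rw [← b.sum_repr e]
    refine sum_mem fun m _ => ?_
    rw [Algebra.smul_def]
    refine mul_mem ?_ ((IntermediateField.adjoin EJ _).algebraMap_mem ⟨b m, hb_EJ m⟩)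
    have hFI_le : FI ≤ (IntermediateField.adjoin EJ (Set.range fun i : ↥sᶜ => z i)).restrictScalars k := by
      rw [hFI]
      refine IntermediateField.adjoin_le_iff.mpr ?_
      rintro _ ⟨i, rfl⟩
      by_cases hi : i ∈ s
      · have hzi : z i ∈ EJ := hFJ_EJ (IntermediateField.subset_adjoin k (z '' s) ⟨i, hi, rfl⟩)
        exact (IntermediateField.adjoin EJ _).algebraMap_mem ⟨z i, hzi⟩
      · exact IntermediateField.subset_adjoin EJ _ ⟨⟨i, hi⟩, rfl⟩
    exact hFI_le (b.repr e m).2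
  -- `EJ` is relatively algebraically closed in `E = EJ(z_{I ∖ J})`
  have hrac : ∀ y : E, IsAlgebraic EJ y → y ∈ EJ := by
    intro y hy
    have hytop : y ∈ IntermediateField.adjoin EJ (Set.range fun i : ↥sᶜ => z i) := by
      rw [htop]
      exact IntermediateField.mem_top
    obtain ⟨T₀, hT₀sub, hyT₀⟩ := IntermediateField.exists_finset_of_mem_adjoin hytop
    haveI : Fintype (↥(T₀ : Set E)) := T₀.finite_toSet.fintype
    have ht : AlgebraicIndependent EJ ((↑) : ↥(T₀ : Set E) → E) :=
      hzT.to_subtype_range.mono hT₀sub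
    refine Literature.FieldTheory.Regular.mem_of_isAlgebraic_of_mem_adjoin_of_algebraicIndependent
      (F₀ := k) EJ ((↑) : ↥(T₀ : Set E) → E) ht ?_ hy
    rwa [Subtype.range_coe]
  -- `EJ` is finitely generated over `k`
  have hEJ_eq : EJ = IntermediateField.adjoin k (z '' s ∪ Set.range b) :=
    IntermediateField.adjoin_adjoin_left k (z '' s) (Set.range b)
  have hEJ_fg : EJ.FG := by
    rw [hEJ_eq]
    refine IntermediateField.fg_adjoin_of_finite (Set.Finite.union ?_ (Set.finite_range _))
    rw [hzs]
    exact S₀.finite_toSet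
  exact ⟨EJ, fun t ht => hT_EJ ⟨t, ht⟩, hEJ_fg, hrac⟩

/-- The same for the rational function field itself: for `z : I → E` algebraically independent over
`k` with `E` finite over `k(z_I)` and a finite `T ⊆ E`, the field `E_J ⊇ T` of
`exists_fg_intermediateField_relAlgClosed` is in particular an intermediate field over which every
element of `E` that is a root of a nonzero polynomial with coefficients in `E_J` already lies in `E_J`
(relative algebraic closedness, spelled with minimal hypotheses for consumers working with
`Polynomial`s over `E`). [cite: MochizukiAbsTopIII2015, Rmk 1.5.4 (iii) p.34] -/
theorem exists_fg_intermediateField_mem_of_isRoot {k E : Type u} [Field k] [Field E] [Algebra k E]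
    [CharZero E] {I : Type*} (z : I → E) (hz : AlgebraicIndependent k z)
    [Module.Finite (IntermediateField.adjoin k (Set.range z)) E] (T : Finset E) :
    ∃ EJ : IntermediateField k E, (↑T : Set E) ⊆ EJ ∧ EJ.FG ∧
      ∀ (y : E) (P : E[X]), P ≠ 0 → (∀ n, P.coeff n ∈ EJ) → P.IsRoot y → y ∈ EJ := by
  obtain ⟨EJ, hT, hfg, hrac⟩ := exists_fg_intermediateField_relAlgClosed z hz T
  exact ⟨EJ, hT, hfg, fun y P hP0 hcoef hroot => hrac y (isAlgebraic_of_poly' EJ P hP0 hcoef hroot)⟩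

end Literature.AnabelianGeometry.AbsoluteAnabelian.AbsTopIII
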